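import Mathlib.Analysis.Complex.ExponentialBounds
import Summits.Ventures.WeilGRH.DualTrigCertMod13Class2Log5Half
import Summits.Ventures.WeilGRH.DualTrigCertMod13Class6Log5Half
import Summits.Ventures.WeilGRH.DualTrigCertMod13OddLog5HalfConj
import HarnessLib

/-!
# Every odd Dirichlet character mod 13: Weil positivity on `[−(log 5)/2, (log 5)/2]`, at the ζ frontier `4023/5000`, and at `log 2`

Cell `rh-explicit`, WEIL TRACK — GRH ARM, route B (weil-grh-3, gen14).  Assembly (no kernel work) of the three format-D-K
instance files of the odd key classes of conductor 13 at the standard rung `N = 4`, `t = (log 5)/2`: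
`DualTrigCertMod13Class2Log5Half` (census `13.2`/`13.7`: `χ(2) = e(±1/12)`), `DualTrigCertMod13Class6Log5Half`
(`13.6`/`13.11`: `χ(2) = e(±5/12)`) and `DualTrigCertMod13OddLog5HalfConj` (`13.5`/`13.8`: `χ(2) = ±i`, over gen2's certificate).
Since `2` generates `(ℤ/13)ˣ`, `χ(2)¹² = 1`; for an odd character `χ(2)⁶ = χ(−1) = −1`, so `χ(2) = e(k/12)` with `k` odd —
exactly the six certified classes.  Headline: `weilPositivityOnChar_mod13_log5half_of_odd` — for EVERY Dirichlet character `χ`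
mod 13 with `χ(−1) = −1` and every smooth `g` supported in `[−(log 5)/2, (log 5)/2]`, `Re W_χ(g ⋆ g̃) ≥ 0`; corollaries at the
ζ frontier `4023/5000` and at `log 2` by `WeilPositivityOnChar.mono`.  (The quadratic character mod 13 is even, `13 ≡ 1 (mod 4)`,
so "odd mod 13" = the six complex characters of orders 4 and 12.)  Honest scope: theorems for these characters and windows only.
No named facts, no `sorry`; axioms standard.
-/

namespace Summit.Ventures.WeilGRH

open Literature.NumberTheory.LFunctions

/-- `exp (2πi/12)^k = exp (2πi·(k/12))`. [folklore] -/
theorem exp_twelfth_pow (k : ℕ) :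
    Complex.exp (2 * Real.pi * Complex.I / 12) ^ k = Complex.exp (2 * Real.pi * Complex.I * ((k : ℂ) / 12)) := by
  rw [← Complex.exp_nat_mul]; congr 1; ring

/-- **Every ODD Dirichlet character mod 13 satisfies Weil positivity on `[−(log 5)/2, (log 5)/2]`.**  `2` generates `(ℤ/13)ˣ`,
`χ(2)¹² = 1` and `χ(2)⁶ = χ(−1) = −1`, so `χ(2) = e(k/12)` with `k` odd: `k = 1, 11` are the census classes `13.2`/`13.7`
(`DualTrigCertMod13Class2Log5Half`), `k = 5, 7` are `13.6`/`13.11` (`DualTrigCertMod13Class6Log5Half`), `k = 3, 9` (`χ(2) = ±i`)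
the odd quartic pair (`DualTrigCertMod13OddLog5HalfConj`) — six kernel-certified key classes, one per case. [folklore] -/
theorem weilPositivityOnChar_mod13_log5half_of_odd (χ : DirichletCharacter ℂ 13) (hχ : χ.Odd) :
    WeilPositivityOnChar χ (Real.log 5 / 2) := by
  have h12 : χ (2 : ZMod 13) ^ 12 = 1 := by
    rw [← map_pow, show (2 : ZMod 13) ^ 12 = 1 by decide, map_one]
  have h6 : χ (2 : ZMod 13) ^ 6 = -1 := by
    rw [← map_pow, show (2 : ZMod 13) ^ 6 = -1 by decide]; exact hχ
  have hprim : IsPrimitiveRoot (Complex.exp (2 * Real.pi * Complex.I / 12)) 12 :=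
    Complex.isPrimitiveRoot_exp 12 (by norm_num)
  obtain ⟨k, hk, hζ⟩ := hprim.eq_pow_of_pow_eq_one h12
  rw [exp_twelfth_pow] at hζ
  -- `χ(2) = e(k/12)`; the parity condition `e(k/12)^6 = e(k/2) = −1` kills the even `k`
  have hodd : ¬ (∃ j : ℕ, k = 2 * j) := by
    rintro ⟨j, rfl⟩
    have h1 : χ (2 : ZMod 13) ^ 6 = 1 := by
      rw [← hζ, ← Complex.exp_nat_mul, Complex.exp_eq_one_iff]
      exact ⟨(j : ℤ), by push_cast; ring⟩
    rw [h1] at h6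
    norm_num at h6
  interval_cases k
  · exact absurd ⟨0, rfl⟩ hodd
  · exact weilPositivityOnChar_mod13_class2_log5half χ (by rw [← hζ]; push_cast; ring_nf)
  · exact absurd ⟨1, rfl⟩ hodd
  · refine weilPositivityOnChar_mod13_odd_chi2_I_log5half χ ?_
    rw [← hζ]
    conv_rhs => rw [DKCert.I_eq_expPhase]
    rw [Complex.exp_eq_exp_iff_exists_int]
    exact ⟨0, by push_cast; ring⟩
  · exact absurd ⟨2, rfl⟩ hodd
  · exact weilPositivityOnChar_mod13_class6_log5half χ (by rw [← hζ]; push_cast; ring_nf)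
  · exact absurd ⟨3, rfl⟩ hodd
  · refine weilPositivityOnChar_mod13_class6_log5half_conj χ ?_
    rw [← hζ, Complex.exp_eq_exp_iff_exists_int]
    exact ⟨1, by push_cast; ring⟩
  · exact absurd ⟨4, rfl⟩ hodd
  · refine weilPositivityOnChar_mod13_odd_chi2_negI_log5half χ ?_
    rw [← hζ, DKCert.neg_I_eq_expPhase, Complex.exp_eq_exp_iff_exists_int]
    exact ⟨1, by push_cast; ring⟩
  · exact absurd ⟨5, rfl⟩ hodd
  · refine weilPositivityOnChar_mod13_class2_log5half_conj χ ?_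
    rw [← hζ, Complex.exp_eq_exp_iff_exists_int]
    exact ⟨1, by push_cast; ring⟩

/-- **The ζ frontier `4023/5000` for every odd Dirichlet character mod 13.** [folklore] -/
theorem weilPositivityOnChar_mod13_frontier_of_odd (χ : DirichletCharacter ℂ 13) (hχ : χ.Odd) :
    WeilPositivityOnChar χ (4023 / 5000) :=
  (weilPositivityOnChar_mod13_log5half_of_odd χ hχ).mono (by have h := Real.log_five_gt_d9; linarith)

/-- **`t = log 2` for every odd Dirichlet character mod 13** (`log 2 ≤ (log 5)/2` since `4 ≤ 5`). [folklore] -/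
theorem weilPositivityOnChar_mod13_log_two_of_odd (χ : DirichletCharacter ℂ 13) (hχ : χ.Odd) :
    WeilPositivityOnChar χ (Real.log 2) := by
  refine (weilPositivityOnChar_mod13_log5half_of_odd χ hχ).mono ?_
  have h4 : Real.log 4 = 2 * Real.log 2 := by
    rw [show (4 : ℝ) = 2 ^ 2 by norm_num, Real.log_pow]; push_cast; ring
  have h45 : Real.log 4 ≤ Real.log 5 := Real.log_le_log (by norm_num) (by norm_num)
  linarith

end Summit.Ventures.WeilGRH
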